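import Literature.Probability.Percolation.TriDiscShelling
import Literature.Probability.LatticeModels.TriangularLatticeProofs
import Mathlib.Analysis.Convex.Segment
import HarnessLib

/-!
# Segments of the embedded triangular lattice: unit edges, face centres and their crossings

Topic `Literature/Probability/Percolation`. Elementary planar geometry of the equilateral
embedding `triEmbed` of `𝕋` and of the centres `hexCenter` of its faces (the vertices of the dual
hexagonal lattice `H`), needed to count the crossings of a closed lattice polyline by the two
kinds of short segments along which the winding number is transported in the proof of Smirnov's
colour-switching lemma (Bollobás–Riordan, *Percolation* (2006), Ch. 7, Claims 7 and 9,
pp. 173–175: the interface, an edge path of `H`, "cannot cross" the cycle `C` of bonds of `𝕋`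
except along `e⃗`): the segment between the centres of two adjacent faces (an edge of `H`), and the
segment from a face centre to a vertex of the face.

* Lattice coordinates `triX`, `triY` (`z = X + Y ζ`), the three forms `lform` = `X`, `Y`, `X + Y`
  whose integral level lines carry the edges of `𝕋` (`ltype k`: the form constant along the
  `k`-th direction, the other two changing by `± 1`, `ldelta`); a point is determined by two
  forms (`eq_of_lform_eq`), two integral forms make a lattice point
  (`exists_eq_triEmbed_of_lform_int`).
* `eq_or_eq_of_triEmbed_mem_unitEdge` — a lattice point on a closed unit edge is an endpoint;
  `unitEdge_inter` — **two closed unit edges meet only at common endpoints, unless they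
  coincide** (the triangular-lattice analogue of `LatticePathArcs.exists_eq_toComplex_of_mem_edgeTrace_inter`
  for `ℤ²`).
* `eq_midpoint_of_mem_segment_hexCenter_oppFace` — the only lattice-line point between the
  centres of two adjacent faces is the midpoint of their common side;
  `eq_vertex_of_mem_segment_hexCenter_faceVertex` — the only lattice-line point between a face
  centre and a vertex of the face is that vertex.
* Consequences for a closed unit edge or lattice point `[a, b]` (`a = b` or `a ∼ b`):
  `eq_side_of_segment_inter_segment_hexCenter` — if it meets the centre–centre segment it *is* the
  common side; `eq_vertex_of_segment_inter_segment_hexCenter_faceVertex` — if it meets the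
  centre–vertex segment it has that vertex as an endpoint.

All statements are folklore planar geometry (proved by lattice coordinates).

## References

* B. Bollobás, O. Riordan, *Percolation*, Cambridge University Press (2006), Ch. 7 §7.2.3,
  pp. 173–175 (the interface as an edge path of the hexagonal lattice; "no edge of the
  interface `I` can cross `C`").

## Mathlib / tree

Mathlib: `segment`, `segment_eq_image'`, `midpoint`, `midpoint_mem_segment`,
`midpoint_eq_left_iff`. Tree: `triEmbed`, `triZeta_re/im`, `hexCenter`, `triEmbed_add`
(`TriangularLattice(Proofs).lean`); `triDir`, `triGraph_adj_iff_triDir`, `faceVertex_succ`,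
`faceDartDir`, `add_triDir_ne` (`TriDiscShelling.lean`); `faceVertex`, `oppFace`
(`TriDiscreteDomain.lean`).
-/

noncomputable section

open Complex Set

namespace Literature.Probability.Percolation

open LatticeModels

/-! ### Lattice coordinates on `ℂ` -/

/-- The second lattice coordinate of a point of the plane in the basis `1, ζ` (`z = X + Y ζ`):
`Y = 2 Im z / √3`. [folklore] -/
def triY (z : ℂ) : ℝ := z.im * 2 / Real.sqrt 3

/-- The first lattice coordinate in the basis `1, ζ`: `X = Re z - Im z / √3`. [folklore] -/
def triX (z : ℂ) : ℝ := z.re - z.im / Real.sqrt 3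

/-- `triX` is additive. [folklore] -/
theorem triX_add (z w : ℂ) : triX (z + w) = triX z + triX w := by unfold triX; simp; ring

/-- `triY` is additive. [folklore] -/
theorem triY_add (z w : ℂ) : triY (z + w) = triY z + triY w := by unfold triY; simp; ring

/-- `triX` is `ℝ`-homogeneous. [folklore] -/
theorem triX_smul (a : ℝ) (z : ℂ) : triX ((a : ℂ) * z) = a * triX z := by unfold triX; simp; ring

/-- `triY` is `ℝ`-homogeneous. [folklore] -/
theorem triY_smul (a : ℝ) (z : ℂ) : triY ((a : ℂ) * z) = a * triY z := by unfold triY; simp; ring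

/-- `triX` is subtractive. [folklore] -/
theorem triX_sub (z w : ℂ) : triX (z - w) = triX z - triX w := by unfold triX; simp; ring

/-- `triY` is subtractive. [folklore] -/
theorem triY_sub (z w : ℂ) : triY (z - w) = triY z - triY w := by unfold triY; simp; ring

/-- `triX` is `ℝ`-affine along segments. [folklore] -/
theorem triX_lineMap (c c' : ℂ) (φ : ℝ) : triX (c + φ • (c' - c)) = triX c + φ * (triX c' - triX c) := by
  rw [Complex.real_smul, triX_add, triX_smul, triX_sub]

/-- `triY` is `ℝ`-affine along segments. [folklore] -/
theorem triY_lineMap (c c' : ℂ) (φ : ℝ) : triY (c + φ • (c' - c)) = triY c + φ * (triY c' - triY c) := by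
  rw [Complex.real_smul, triY_add, triY_smul, triY_sub]

/-- The lattice coordinates of a lattice point. [folklore] -/
theorem triX_triEmbed (x : Site 2) : triX (triEmbed x) = x 0 := by
  have h3 : Real.sqrt 3 ≠ 0 := by positivity
  unfold triX triEmbed
  simp [triZeta_re, triZeta_im]
  field_simp
  ring

/-- The lattice coordinates of a lattice point. [folklore] -/
theorem triY_triEmbed (x : Site 2) : triY (triEmbed x) = x 1 := by
  have h3 : Real.sqrt 3 ≠ 0 := by positivity
  unfold triY triEmbed
  simp [triZeta_re, triZeta_im]
  field_simp

/-- The lattice coordinates of a face centre: `(x₀ + (t+1)/3, x₁ + (t+1)/3)`. [folklore] -/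
theorem triX_hexCenter (x : Site 2) (t : Fin 2) : triX (hexCenter (x, t)) = x 0 + ((t : ℕ) + 1) / 3 := by
  have h3 : Real.sqrt 3 ≠ 0 := by positivity
  unfold triX hexCenter triEmbed
  simp [triZeta_re, triZeta_im]
  field_simp
  ring

/-- The lattice coordinates of a face centre. [folklore] -/
theorem triY_hexCenter (x : Site 2) (t : Fin 2) : triY (hexCenter (x, t)) = x 1 + ((t : ℕ) + 1) / 3 := by
  have h3 : Real.sqrt 3 ≠ 0 := by positivity
  unfold triY hexCenter triEmbed
  simp [triZeta_re, triZeta_im]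
  field_simp

/-- **`triEmbed` is injective.** [folklore] -/
theorem triEmbed_injective : Function.Injective triEmbed := by
  intro x y h
  have hX := congrArg triX h
  have hY := congrArg triY h
  rw [triX_triEmbed, triX_triEmbed] at hX
  rw [triY_triEmbed, triY_triEmbed] at hY
  ext i; fin_cases i
  · exact_mod_cast hX
  · exact_mod_cast hY

/-- **A point of the plane is determined by its two lattice coordinates.** [folklore] -/
theorem triXY_ext {z w : ℂ} (hX : triX z = triX w) (hY : triY z = triY w) : z = w := by
  have h3 : Real.sqrt 3 ≠ 0 := by positivity
  unfold triX at hX; unfold triY at hY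
  apply Complex.ext
  · have : z.im = w.im := by
      field_simp at hY; linarith
    rw [this] at hX; linarith
  · field_simp at hY; linarith

/-- The coordinates of the six directions. [folklore] -/
theorem triDir_fst_cast (k : Fin 6) : ((triDir k 0 : ℤ) : ℝ) = ![1, 0, -1, -1, 0, 1] k := by
  fin_cases k <;> simp [triDir]

/-- The coordinates of the six directions. [folklore] -/
theorem triDir_snd_cast (k : Fin 6) : ((triDir k 1 : ℤ) : ℝ) = ![0, 1, 1, 0, -1, -1] k := by
  fin_cases k <;> simp [triDir]

/-! ### The three lattice forms `X`, `Y`, `X + Y` -/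

/-- The three linear forms whose integral level lines carry the edges of `𝕋`: `X` (constant
along the edges `± e₁`), `Y` (constant along `± e₀`) and `X + Y` (constant along `± (e₁ - e₀)`). [folklore] -/
def lform (i : Fin 3) (p : ℂ) : ℝ := ![triX p, triY p, triX p + triY p] i

/-- The change of the `i`-th form along the `k`-th direction. [folklore] -/
def ldelta (k : Fin 6) (i : Fin 3) : ℝ :=
  ![![(1 : ℝ), 0, 1], ![0, 1, 1], ![-1, 1, 0], ![-1, 0, -1], ![0, -1, -1], ![1, -1, 0]] k i

/-- The form constant along the `k`-th direction (its "type"). [folklore] -/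
def ltype : Fin 6 → Fin 3 := ![1, 0, 2, 1, 0, 2]

/-- The type form does not change along its direction. [folklore] -/
theorem ldelta_ltype (k : Fin 6) : ldelta k (ltype k) = 0 := by
  fin_cases k <;> simp [ldelta, ltype]

/-- The other two forms change by `± 1`. [folklore] -/
theorem ldelta_eq_one_or_of_ne {k : Fin 6} {i : Fin 3} (h : i ≠ ltype k) : ldelta k i = 1 ∨ ldelta k i = -1 := by
  revert h; fin_cases k <;> fin_cases i <;> simp [ldelta, ltype]

/-- `lform 0 = X`. [folklore] -/
@[simp] theorem lform_zero (p : ℂ) : lform 0 p = triX p := rfl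

/-- `lform 1 = Y`. [folklore] -/
@[simp] theorem lform_one (p : ℂ) : lform 1 p = triY p := rfl

/-- `lform 2 = X + Y`. [folklore] -/
@[simp] theorem lform_two (p : ℂ) : lform 2 p = triX p + triY p := rfl

/-- The forms are affine along segments. [folklore] -/
theorem lform_lineMap (i : Fin 3) (c c' : ℂ) (φ : ℝ) :
    lform i (c + φ • (c' - c)) = lform i c + φ * (lform i c' - lform i c) := by
  fin_cases i
  · exact triX_lineMap c c' φ
  · exact triY_lineMap c c' φ
  · change triX _ + triY _ = triX c + triY c + φ * (triX c' + triY c' - (triX c + triY c))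
    rw [triX_lineMap, triY_lineMap]; ring

/-- The forms of a lattice point are integers. [folklore] -/
theorem lform_triEmbed (i : Fin 3) (a : Site 2) : lform i (triEmbed a) = ((![a 0, a 1, a 0 + a 1] i : ℤ) : ℝ) := by
  fin_cases i <;> simp [lform, triX_triEmbed, triY_triEmbed]

/-- The forms along a step: `F_i(a + dir k) = F_i(a) + Δ_i(k)`. [folklore] -/
theorem lform_triEmbed_add_triDir (i : Fin 3) (a : Site 2) (k : Fin 6) :
    lform i (triEmbed (a + triDir k)) = lform i (triEmbed a) + ldelta k i := by
  rw [lform_triEmbed, lform_triEmbed]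
  fin_cases i <;> fin_cases k <;> simp [ldelta, triDir] <;> ring

/-- **Two forms determine the point.** [folklore] -/
theorem eq_of_lform_eq {p q : ℂ} {i i' : Fin 3} (hne : i ≠ i') (h1 : lform i p = lform i q)
    (h2 : lform i' p = lform i' q) : p = q := by
  have key : triX p = triX q ∧ triY p = triY q := by
    revert hne h1 h2
    fin_cases i <;> fin_cases i' <;> simp [lform] <;> intro h1 h2 <;> constructor <;> linarith
  exact triXY_ext key.1 key.2

/-- No integer strictly between consecutive integers (real form). [folklore] -/
theorem int_not_strict_between {n m : ℤ} (h1 : (m : ℝ) < n) (h2 : (n : ℝ) < m + 1) : False := by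
  have h1' : m < n := by exact_mod_cast h1
  have h2' : n < m + 1 := by exact_mod_cast h2
  omega

/-- **Two integral forms make a lattice point.** [folklore] -/
theorem exists_eq_triEmbed_of_lform_int {p : ℂ} {i i' : Fin 3} (hne : i ≠ i') {n n' : ℤ}
    (h1 : lform i p = n) (h2 : lform i' p = n') : ∃ v : Site 2, p = triEmbed v := by
  have key : ∃ ab : ℤ × ℤ, triX p = ab.1 ∧ triY p = ab.2 := by
    obtain rfl | rfl | rfl : i = 0 ∨ i = 1 ∨ i = 2 := by fin_cases i <;> simp
    all_goals obtain rfl | rfl | rfl : i' = 0 ∨ i' = 1 ∨ i' = 2 := by fin_cases i' <;> simp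
    all_goals simp only [lform_zero, lform_one, lform_two] at h1 h2
    · exact absurd rfl hne
    · exact ⟨(n, n'), h1, h2⟩
    · exact ⟨(n, n' - n), h1, by push_cast; linarith⟩
    · exact ⟨(n', n), h2, h1⟩
    · exact absurd rfl hne
    · exact ⟨(n' - n, n), by push_cast; linarith, h1⟩
    · exact ⟨(n', n - n'), h2, by push_cast; linarith⟩
    · exact ⟨(n - n', n'), by push_cast; linarith, h2⟩
    · exact absurd rfl hne
  obtain ⟨⟨a, b⟩, ha, hb⟩ := key
  refine ⟨![a, b], triXY_ext ?_ ?_⟩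
  · rw [ha, triX_triEmbed]; simp
  · rw [hb, triY_triEmbed]; simp

/-! ### Points of a unit edge -/

/-- **The forms along a unit edge**: a point of the closed edge `[a, a + dir k]` is
`a + θ dir k`, `θ ∈ [0, 1]`, in every form. [folklore] -/
theorem exists_param_of_mem_unitEdge {a : Site 2} {k : Fin 6} {p : ℂ}
    (hp : p ∈ segment ℝ (triEmbed a) (triEmbed (a + triDir k))) :
    ∃ θ : ℝ, 0 ≤ θ ∧ θ ≤ 1 ∧ ∀ i, lform i p = lform i (triEmbed a) + θ * ldelta k i := by
  rw [segment_eq_image'] at hp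
  obtain ⟨θ, ⟨h0, h1⟩, rfl⟩ := hp
  refine ⟨θ, h0, h1, fun i => ?_⟩
  rw [lform_lineMap, lform_triEmbed_add_triDir]; ring

/-- The type form is constant along a unit edge, an integer. [folklore] -/
theorem lform_ltype_of_mem_unitEdge {a : Site 2} {k : Fin 6} {p : ℂ}
    (hp : p ∈ segment ℝ (triEmbed a) (triEmbed (a + triDir k))) :
    lform (ltype k) p = lform (ltype k) (triEmbed a) := by
  obtain ⟨θ, -, -, h⟩ := exists_param_of_mem_unitEdge hp
  rw [h, ldelta_ltype, mul_zero, add_zero]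

/-- **A lattice point on a unit edge is an endpoint.** [folklore] -/
theorem eq_or_eq_of_triEmbed_mem_unitEdge {a v : Site 2} {k : Fin 6}
    (hv : triEmbed v ∈ segment ℝ (triEmbed a) (triEmbed (a + triDir k))) : v = a ∨ v = a + triDir k := by
  obtain ⟨θ, h0, h1, h⟩ := exists_param_of_mem_unitEdge hv
  -- a form changing by `± 1`
  have hi : ltype k + 1 ≠ ltype k := by fin_cases k <;> simp [ltype]
  obtain he | he := ldelta_eq_one_or_of_ne hi
  all_goals
    have hθ := h (ltype k + 1)
    rw [he, lform_triEmbed, lform_triEmbed] at hθ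
    have key : θ = 0 ∨ θ = 1 := by
      rcases h0.lt_or_eq with h0' | rfl
      · rcases h1.lt_or_eq with h1' | rfl
        · exfalso
          first
          | exact int_not_strict_between (n := ![v 0, v 1, v 0 + v 1] (ltype k + 1))
              (m := ![a 0, a 1, a 0 + a 1] (ltype k + 1)) (by linarith) (by linarith)
          | exact int_not_strict_between (n := ![v 0, v 1, v 0 + v 1] (ltype k + 1))
              (m := ![a 0, a 1, a 0 + a 1] (ltype k + 1) - 1) (by push_cast; linarith) (by push_cast; linarith)
        · exact Or.inr rfl
      · exact Or.inl rfl
    rcases key with rfl | rfl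
    · left
      have : triEmbed v = triEmbed a := eq_of_lform_eq hi (by rw [h, zero_mul, add_zero])
        (by rw [h, zero_mul, add_zero])
      exact triEmbed_injective this
    · right
      have : triEmbed v = triEmbed (a + triDir k) := eq_of_lform_eq hi
        (by rw [h, lform_triEmbed_add_triDir, one_mul]) (by rw [h, lform_triEmbed_add_triDir, one_mul])
      exact triEmbed_injective this


/-! ### Two unit edges meet only at common endpoints -/

/-- An integer squeezed strictly between `m` and `m + 2` is `m + 1` (real form). [folklore] -/
theorem int_eq_of_between {n m : ℤ} (h1 : (m : ℝ) < n) (h2 : (n : ℝ) < m + 2) : n = m + 1 := by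
  have h1' : m < n := by exact_mod_cast h1
  have h2' : n < m + 2 := by exact_mod_cast h2
  omega

/-- **Two unit integer intervals on a line**: if `A + θ ε = C + ψ ε'` with integers `A, C`, signs
`ε, ε' = ±1` and `θ, ψ ∈ [0, 1]`, then either both parameters are endpoints, or the two
intervals coincide (in one of the two orientations). [folklore] -/
theorem unit_intervals {A C : ℤ} {ε ε' θ ψ : ℝ} (hε : ε = 1 ∨ ε = -1) (hε' : ε' = 1 ∨ ε' = -1)
    (h0 : 0 ≤ θ) (h1 : θ ≤ 1) (h0' : 0 ≤ ψ) (h1' : ψ ≤ 1) (h : (A : ℝ) + θ * ε = C + ψ * ε') :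
    ((θ = 0 ∨ θ = 1) ∧ (ψ = 0 ∨ ψ = 1)) ∨ (A = C ∧ ε = ε' ∧ θ = ψ) ∨
      ((A : ℝ) + ε = C ∧ (C : ℝ) + ε' = A ∧ θ + ψ = 1) := by
  have hd : -2 ≤ A - C ∧ A - C ≤ 2 := by
    have : (-2 : ℝ) ≤ (A : ℝ) - (C : ℝ) ∧ (A : ℝ) - (C : ℝ) ≤ 2 := by
      rcases hε with rfl | rfl <;> rcases hε' with rfl | rfl <;> constructor <;> linarith
    exact ⟨by exact_mod_cast this.1, by exact_mod_cast this.2⟩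
  obtain ⟨d, hdAC⟩ : ∃ d : ℤ, A = C + d := ⟨A - C, by ring⟩
  have hdb1 : -2 ≤ d := by omega
  have hdb2 : d ≤ 2 := by omega
  subst hdAC
  push_cast at h
  rcases hε with rfl | rfl <;> rcases hε' with rfl | rfl
  all_goals
    interval_cases d
    all_goals push_cast at h ⊢
    all_goals
      first
      | (left; constructor <;> [left; right] <;> linarith)
      | (left; constructor <;> [right; left] <;> linarith)
      | (left; constructor <;> [left; left] <;> linarith)
      | (left; constructor <;> [right; right] <;> linarith)
      | (right; left; exact ⟨by ring, rfl, by linarith⟩)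
      | (right; right; exact ⟨by ring, by ring, by linarith⟩)


/-- A point of a unit edge with parameter `θ = 0` or `θ = 1` is an endpoint. [folklore] -/
theorem eq_endpoint_of_param {a : Site 2} {k : Fin 6} {q : ℂ} {θ : ℝ}
    (h : ∀ i, lform i q = lform i (triEmbed a) + θ * ldelta k i) (hθ : θ = 0 ∨ θ = 1) :
    q = triEmbed a ∨ q = triEmbed (a + triDir k) := by
  have hi : (0 : Fin 3) ≠ 1 := by decide
  rcases hθ with rfl | rfl
  · left
    exact eq_of_lform_eq hi (by rw [h, zero_mul, add_zero]) (by rw [h, zero_mul, add_zero])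
  · right
    exact eq_of_lform_eq hi (by rw [h, lform_triEmbed_add_triDir, one_mul])
      (by rw [h, lform_triEmbed_add_triDir, one_mul])

/-- **Two unit edges of `𝕋` meet only at common endpoints, unless they coincide**: a common
point of the closed edges `[a, a + dir k]` and `[c, c + dir l]` is an endpoint of both, or the
two edges have the same endpoints. [folklore] -/
theorem unitEdge_inter {a c : Site 2} {k l : Fin 6} {q : ℂ}
    (hq1 : q ∈ segment ℝ (triEmbed a) (triEmbed (a + triDir k)))
    (hq2 : q ∈ segment ℝ (triEmbed c) (triEmbed (c + triDir l))) :
    ((q = triEmbed a ∨ q = triEmbed (a + triDir k)) ∧ (q = triEmbed c ∨ q = triEmbed (c + triDir l))) ∨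
      (a = c ∧ a + triDir k = c + triDir l) ∨ (a = c + triDir l ∧ a + triDir k = c) := by
  obtain ⟨θ, h0, h1, hθ⟩ := exists_param_of_mem_unitEdge hq1
  obtain ⟨ψ, h0', h1', hψ⟩ := exists_param_of_mem_unitEdge hq2
  by_cases ht : ltype k = ltype l
  · -- same type: the two edges lie on parallel lines, in fact on the same line
    set τ := ltype k with hτ
    have hi : τ + 1 ≠ τ := by fin_cases k <;> simp [hτ, ltype]
    have hi' : τ + 1 ≠ ltype l := by rw [← ht]; exact hi
    obtain hεk := ldelta_eq_one_or_of_ne hi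
    obtain hεl := ldelta_eq_one_or_of_ne hi'
    -- the common value of the form `τ + 1`
    have hline : lform τ (triEmbed a) = lform τ (triEmbed c) := by
      have h1 := hθ τ; have h2 := hψ τ
      rw [ldelta_ltype, mul_zero, add_zero] at h1
      rw [show ldelta l τ = 0 by rw [ht]; exact ldelta_ltype l, mul_zero, add_zero] at h2
      rw [← h1, ← h2]
    have hA := hθ (τ + 1); have hC := hψ (τ + 1)
    rw [lform_triEmbed] at hA hC
    have key := unit_intervals (A := ![a 0, a 1, a 0 + a 1] (τ + 1)) (C := ![c 0, c 1, c 0 + c 1] (τ + 1))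
      hεk hεl h0 h1 h0' h1' (by rw [← hA, ← hC])
    rcases key with ⟨hθ01, hψ01⟩ | ⟨hAC, hεε, hθψ⟩ | ⟨hAC, hCA, hθψ⟩
    · exact Or.inl ⟨eq_endpoint_of_param hθ hθ01, eq_endpoint_of_param hψ hψ01⟩
    · right; left
      have hac : triEmbed a = triEmbed c := by
        refine eq_of_lform_eq hi.symm hline ?_
        rw [lform_triEmbed, lform_triEmbed]; exact_mod_cast hAC
      refine ⟨triEmbed_injective hac, triEmbed_injective ?_⟩
      refine eq_of_lform_eq hi.symm ?_ ?_
      · rw [lform_triEmbed_add_triDir, lform_triEmbed_add_triDir, ldelta_ltype, ht, ldelta_ltype, ← ht, hline]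
      · rw [lform_triEmbed_add_triDir, lform_triEmbed_add_triDir, lform_triEmbed, lform_triEmbed, hεε]
        exact_mod_cast congrArg (fun z : ℝ => z + ldelta l (τ + 1)) (show ((![a 0, a 1, a 0 + a 1] (τ + 1) : ℤ) : ℝ) = _ from by exact_mod_cast hAC)
    · right; right
      constructor
      · apply triEmbed_injective
        refine eq_of_lform_eq hi.symm ?_ ?_
        · rw [lform_triEmbed_add_triDir, ht, ldelta_ltype, add_zero, ← ht, hline]
        · rw [lform_triEmbed_add_triDir, lform_triEmbed, lform_triEmbed]; exact hCA.symm
      · apply triEmbed_injective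
        refine eq_of_lform_eq hi.symm ?_ ?_
        · rw [lform_triEmbed_add_triDir, ldelta_ltype, add_zero, hline]
        · rw [lform_triEmbed_add_triDir, lform_triEmbed, lform_triEmbed]; exact hAC
  · -- different types: two distinct integral forms at `q`, a lattice point
    have h1i : lform (ltype k) q = ((![a 0, a 1, a 0 + a 1] (ltype k) : ℤ) : ℝ) := by
      rw [lform_ltype_of_mem_unitEdge hq1, lform_triEmbed]
    have h2i : lform (ltype l) q = ((![c 0, c 1, c 0 + c 1] (ltype l) : ℤ) : ℝ) := by
      rw [lform_ltype_of_mem_unitEdge hq2, lform_triEmbed]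
    obtain ⟨v, rfl⟩ := exists_eq_triEmbed_of_lform_int ht h1i h2i
    left
    constructor
    · rcases eq_or_eq_of_triEmbed_mem_unitEdge hq1 with rfl | rfl
      · exact Or.inl rfl
      · exact Or.inr rfl
    · rcases eq_or_eq_of_triEmbed_mem_unitEdge hq2 with rfl | rfl
      · exact Or.inl rfl
      · exact Or.inr rfl


/-! ### Midpoints -/

/-- `triX` of a midpoint. [folklore] -/
theorem triX_midpoint (z w : ℂ) : triX (midpoint ℝ z w) = (triX z + triX w) / 2 := by
  rw [midpoint_eq_smul_add, Complex.real_smul, triX_smul, triX_add]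
  simp; ring

/-- `triY` of a midpoint. [folklore] -/
theorem triY_midpoint (z w : ℂ) : triY (midpoint ℝ z w) = (triY z + triY w) / 2 := by
  rw [midpoint_eq_smul_add, Complex.real_smul, triY_smul, triY_add]
  simp; ring

/-! ### The segment between the centres of adjacent faces -/

/-- **The only lattice-line point between two adjacent face centres is the midpoint of the common
side**: if a point of the closed segment from the centre of `F` to the centre of the face opposite
its `j`-th vertex has an integral form (`X`, `Y` or `X + Y`), it is the midpoint of the side
from the `(j+1)`-st to the `(j+2)`-nd vertex. [folklore] -/
theorem eq_midpoint_of_mem_segment_hexCenter_oppFace {F : HexVertex} {j : Fin 3} {q : ℂ}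
    (hq : q ∈ segment ℝ (hexCenter F) (hexCenter (oppFace F j))) {i : Fin 3} {n : ℤ} (hn : lform i q = n) :
    q = midpoint ℝ (triEmbed (faceVertex F (j + 1))) (triEmbed (faceVertex F (j + 2))) := by
  rw [segment_eq_image'] at hq
  obtain ⟨φ, ⟨h0, h1⟩, rfl⟩ := hq
  rw [lform_lineMap] at hn
  rcases F with ⟨x, t⟩
  obtain rfl | rfl : t = 0 ∨ t = 1 := by
    rcases Fin.exists_fin_two.1 ⟨t, rfl⟩ with h' | h'
    · exact Or.inl h'
    · exact Or.inr h'
  all_goals obtain rfl | rfl | rfl : j = 0 ∨ j = 1 ∨ j = 2 := by fin_cases j <;> simp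
  · -- up/down = 0, side j = 0: opposite face `(x, 1)`
    rw [show oppFace (x, 0) 0 = (x, 1) from rfl] at hn ⊢
    rw [show faceVertex (x, 0) (0 + 1) = x + Pi.single 0 1 from rfl,
      show faceVertex (x, 0) (0 + 2) = x + Pi.single 1 1 from rfl]
    have hφ : φ = 1 / 2 := by
      obtain rfl | rfl | rfl : i = 0 ∨ i = 1 ∨ i = 2 := by fin_cases i <;> simp
      · simp only [lform_zero, triX_hexCenter] at hn
        simp at hn
        exfalso
        exact int_not_strict_between (n := n) (m := x 0 + (0)) (by push_cast; linarith) (by push_cast; linarith)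
      · simp only [lform_one, triY_hexCenter] at hn
        simp at hn
        exfalso
        exact int_not_strict_between (n := n) (m := x 1 + (0)) (by push_cast; linarith) (by push_cast; linarith)
      · simp only [lform_two, triX_hexCenter, triY_hexCenter] at hn
        simp at hn
        have hsq := int_eq_of_between (n := n) (m := x 0 + x 1 + (0)) (by push_cast; linarith) (by push_cast; linarith)
        rw [hsq] at hn; push_cast at hn; linarith
    subst hφ
    apply triXY_ext
    · rw [triX_lineMap, triX_midpoint, triX_hexCenter, triX_hexCenter, triX_triEmbed, triX_triEmbed]
      simp; ring
    · rw [triY_lineMap, triY_midpoint, triY_hexCenter, triY_hexCenter, triY_triEmbed, triY_triEmbed]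
      simp; ring
  · -- up/down = 0, side j = 1: opposite face `(x-e0, 1)`
    rw [show oppFace (x, 0) 1 = (x - Pi.single 0 1, 1) from rfl] at hn ⊢
    rw [show faceVertex (x, 0) (1 + 1) = x + Pi.single 1 1 from rfl,
      show faceVertex (x, 0) (1 + 2) = x from rfl]
    have hφ : φ = 1 / 2 := by
      obtain rfl | rfl | rfl : i = 0 ∨ i = 1 ∨ i = 2 := by fin_cases i <;> simp
      · simp only [lform_zero, triX_hexCenter] at hn
        simp at hn
        have hsq := int_eq_of_between (n := n) (m := x 0 + (-1)) (by push_cast; linarith) (by push_cast; linarith)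
        rw [hsq] at hn; push_cast at hn; linarith
      · simp only [lform_one, triY_hexCenter] at hn
        simp at hn
        exfalso
        exact int_not_strict_between (n := n) (m := x 1 + (0)) (by push_cast; linarith) (by push_cast; linarith)
      · simp only [lform_two, triX_hexCenter, triY_hexCenter] at hn
        simp at hn
        exfalso
        exact int_not_strict_between (n := n) (m := x 0 + x 1 + (0)) (by push_cast; linarith) (by push_cast; linarith)
    subst hφ
    apply triXY_ext
    · rw [triX_lineMap, triX_midpoint, triX_hexCenter, triX_hexCenter, triX_triEmbed, triX_triEmbed]
      simp; ring
    · rw [triY_lineMap, triY_midpoint, triY_hexCenter, triY_hexCenter, triY_triEmbed, triY_triEmbed]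
      simp; ring
  · -- up/down = 0, side j = 2: opposite face `(x-e1, 1)`
    rw [show oppFace (x, 0) 2 = (x - Pi.single 1 1, 1) from rfl] at hn ⊢
    rw [show faceVertex (x, 0) (2 + 1) = x from rfl,
      show faceVertex (x, 0) (2 + 2) = x + Pi.single 0 1 from rfl]
    have hφ : φ = 1 / 2 := by
      obtain rfl | rfl | rfl : i = 0 ∨ i = 1 ∨ i = 2 := by fin_cases i <;> simp
      · simp only [lform_zero, triX_hexCenter] at hn
        simp at hn
        exfalso
        exact int_not_strict_between (n := n) (m := x 0 + (0)) (by push_cast; linarith) (by push_cast; linarith)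
      · simp only [lform_one, triY_hexCenter] at hn
        simp at hn
        have hsq := int_eq_of_between (n := n) (m := x 1 + (-1)) (by push_cast; linarith) (by push_cast; linarith)
        rw [hsq] at hn; push_cast at hn; linarith
      · simp only [lform_two, triX_hexCenter, triY_hexCenter] at hn
        simp at hn
        exfalso
        exact int_not_strict_between (n := n) (m := x 0 + x 1 + (0)) (by push_cast; linarith) (by push_cast; linarith)
    subst hφ
    apply triXY_ext
    · rw [triX_lineMap, triX_midpoint, triX_hexCenter, triX_hexCenter, triX_triEmbed, triX_triEmbed]
      simp; ring
    · rw [triY_lineMap, triY_midpoint, triY_hexCenter, triY_hexCenter, triY_triEmbed, triY_triEmbed]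
      simp; ring
  · -- up/down = 1, side j = 0: opposite face `(x+e1, 0)`
    rw [show oppFace (x, 1) 0 = (x + Pi.single 1 1, 0) from rfl] at hn ⊢
    rw [show faceVertex (x, 1) (0 + 1) = x + Pi.single 0 1 + Pi.single 1 1 from rfl,
      show faceVertex (x, 1) (0 + 2) = x + Pi.single 1 1 from rfl]
    have hφ : φ = 1 / 2 := by
      obtain rfl | rfl | rfl : i = 0 ∨ i = 1 ∨ i = 2 := by fin_cases i <;> simp
      · simp only [lform_zero, triX_hexCenter] at hn
        simp at hn
        exfalso
        exact int_not_strict_between (n := n) (m := x 0 + (0)) (by push_cast; linarith) (by push_cast; linarith)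
      · simp only [lform_one, triY_hexCenter] at hn
        simp at hn
        have hsq := int_eq_of_between (n := n) (m := x 1 + (0)) (by push_cast; linarith) (by push_cast; linarith)
        rw [hsq] at hn; push_cast at hn; linarith
      · simp only [lform_two, triX_hexCenter, triY_hexCenter] at hn
        simp at hn
        exfalso
        exact int_not_strict_between (n := n) (m := x 0 + x 1 + (1)) (by push_cast; linarith) (by push_cast; linarith)
    subst hφ
    apply triXY_ext
    · rw [triX_lineMap, triX_midpoint, triX_hexCenter, triX_hexCenter, triX_triEmbed, triX_triEmbed]
      simp; ring
    · rw [triY_lineMap, triY_midpoint, triY_hexCenter, triY_hexCenter, triY_triEmbed, triY_triEmbed]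
      simp; ring
  · -- up/down = 1, side j = 1: opposite face `(x, 0)`
    rw [show oppFace (x, 1) 1 = (x, 0) from rfl] at hn ⊢
    rw [show faceVertex (x, 1) (1 + 1) = x + Pi.single 1 1 from rfl,
      show faceVertex (x, 1) (1 + 2) = x + Pi.single 0 1 from rfl]
    have hφ : φ = 1 / 2 := by
      obtain rfl | rfl | rfl : i = 0 ∨ i = 1 ∨ i = 2 := by fin_cases i <;> simp
      · simp only [lform_zero, triX_hexCenter] at hn
        simp at hn
        exfalso
        exact int_not_strict_between (n := n) (m := x 0 + (0)) (by push_cast; linarith) (by push_cast; linarith)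
      · simp only [lform_one, triY_hexCenter] at hn
        simp at hn
        exfalso
        exact int_not_strict_between (n := n) (m := x 1 + (0)) (by push_cast; linarith) (by push_cast; linarith)
      · simp only [lform_two, triX_hexCenter, triY_hexCenter] at hn
        simp at hn
        have hsq := int_eq_of_between (n := n) (m := x 0 + x 1 + (0)) (by push_cast; linarith) (by push_cast; linarith)
        rw [hsq] at hn; push_cast at hn; linarith
    subst hφ
    apply triXY_ext
    · rw [triX_lineMap, triX_midpoint, triX_hexCenter, triX_hexCenter, triX_triEmbed, triX_triEmbed]
      simp; ring
    · rw [triY_lineMap, triY_midpoint, triY_hexCenter, triY_hexCenter, triY_triEmbed, triY_triEmbed]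
      simp; ring
  · -- up/down = 1, side j = 2: opposite face `(x+e0, 0)`
    rw [show oppFace (x, 1) 2 = (x + Pi.single 0 1, 0) from rfl] at hn ⊢
    rw [show faceVertex (x, 1) (2 + 1) = x + Pi.single 0 1 from rfl,
      show faceVertex (x, 1) (2 + 2) = x + Pi.single 0 1 + Pi.single 1 1 from rfl]
    have hφ : φ = 1 / 2 := by
      obtain rfl | rfl | rfl : i = 0 ∨ i = 1 ∨ i = 2 := by fin_cases i <;> simp
      · simp only [lform_zero, triX_hexCenter] at hn
        simp at hn
        have hsq := int_eq_of_between (n := n) (m := x 0 + (0)) (by push_cast; linarith) (by push_cast; linarith)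
        rw [hsq] at hn; push_cast at hn; linarith
      · simp only [lform_one, triY_hexCenter] at hn
        simp at hn
        exfalso
        exact int_not_strict_between (n := n) (m := x 1 + (0)) (by push_cast; linarith) (by push_cast; linarith)
      · simp only [lform_two, triX_hexCenter, triY_hexCenter] at hn
        simp at hn
        exfalso
        exact int_not_strict_between (n := n) (m := x 0 + x 1 + (1)) (by push_cast; linarith) (by push_cast; linarith)
    subst hφ
    apply triXY_ext
    · rw [triX_lineMap, triX_midpoint, triX_hexCenter, triX_hexCenter, triX_triEmbed, triX_triEmbed]
      simp; ring
    · rw [triY_lineMap, triY_midpoint, triY_hexCenter, triY_hexCenter, triY_triEmbed, triY_triEmbed]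
      simp; ring

/-! ### The segment from the centre of a face to one of its vertices -/

/-- **The only lattice-line point between a face centre and a vertex of the face is the vertex.** [folklore] -/
theorem eq_vertex_of_mem_segment_hexCenter_faceVertex {F : HexVertex} {v : Fin 3} {q : ℂ}
    (hq : q ∈ segment ℝ (hexCenter F) (triEmbed (faceVertex F v))) {i : Fin 3} {n : ℤ} (hn : lform i q = n) :
    q = triEmbed (faceVertex F v) := by
  rw [segment_eq_image'] at hq
  obtain ⟨φ, ⟨h0, h1⟩, rfl⟩ := hq
  rw [lform_lineMap] at hn
  rcases F with ⟨x, t⟩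
  obtain rfl | rfl : t = 0 ∨ t = 1 := by
    rcases Fin.exists_fin_two.1 ⟨t, rfl⟩ with h' | h'
    · exact Or.inl h'
    · exact Or.inr h'
  all_goals obtain rfl | rfl | rfl : v = 0 ∨ v = 1 ∨ v = 2 := by fin_cases v <;> simp
  · -- up/down = 0, vertex 0
    rw [show faceVertex (x, 0) 0 = x from rfl] at hn ⊢
    have hφ : φ = 1 := by
      obtain rfl | rfl | rfl : i = 0 ∨ i = 1 ∨ i = 2 := by fin_cases i <;> simp
      · simp only [lform_zero, triX_hexCenter, triX_triEmbed] at hn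
        simp at hn
        have hsq := int_eq_of_between (n := n) (m := x 0 + (-1)) (by push_cast; linarith) (by push_cast; linarith)
        rw [hsq] at hn; push_cast at hn; linarith
      · simp only [lform_one, triY_hexCenter, triY_triEmbed] at hn
        simp at hn
        have hsq := int_eq_of_between (n := n) (m := x 1 + (-1)) (by push_cast; linarith) (by push_cast; linarith)
        rw [hsq] at hn; push_cast at hn; linarith
      · simp only [lform_two, triX_hexCenter, triY_hexCenter, triX_triEmbed, triY_triEmbed] at hn
        simp at hn
        have hsq := int_eq_of_between (n := n) (m := x 0 + x 1 + (-1)) (by push_cast; linarith) (by push_cast; linarith)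
        rw [hsq] at hn; push_cast at hn; linarith
    subst hφ
    simp
  · -- up/down = 0, vertex 1
    rw [show faceVertex (x, 0) 1 = x + Pi.single 0 1 from rfl] at hn ⊢
    have hφ : φ = 1 := by
      obtain rfl | rfl | rfl : i = 0 ∨ i = 1 ∨ i = 2 := by fin_cases i <;> simp
      · simp only [lform_zero, triX_hexCenter, triX_triEmbed] at hn
        simp at hn
        have hsq := int_eq_of_between (n := n) (m := x 0 + (0)) (by push_cast; linarith) (by push_cast; linarith)
        rw [hsq] at hn; push_cast at hn; linarith
      · simp only [lform_one, triY_hexCenter, triY_triEmbed] at hn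
        simp at hn
        have hsq := int_eq_of_between (n := n) (m := x 1 + (-1)) (by push_cast; linarith) (by push_cast; linarith)
        rw [hsq] at hn; push_cast at hn; linarith
      · simp only [lform_two, triX_hexCenter, triY_hexCenter, triX_triEmbed, triY_triEmbed] at hn
        simp at hn
        have hsq := int_eq_of_between (n := n) (m := x 0 + x 1 + (0)) (by push_cast; linarith) (by push_cast; linarith)
        rw [hsq] at hn; push_cast at hn; linarith
    subst hφ
    simp
  · -- up/down = 0, vertex 2
    rw [show faceVertex (x, 0) 2 = x + Pi.single 1 1 from rfl] at hn ⊢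
    have hφ : φ = 1 := by
      obtain rfl | rfl | rfl : i = 0 ∨ i = 1 ∨ i = 2 := by fin_cases i <;> simp
      · simp only [lform_zero, triX_hexCenter, triX_triEmbed] at hn
        simp at hn
        have hsq := int_eq_of_between (n := n) (m := x 0 + (-1)) (by push_cast; linarith) (by push_cast; linarith)
        rw [hsq] at hn; push_cast at hn; linarith
      · simp only [lform_one, triY_hexCenter, triY_triEmbed] at hn
        simp at hn
        have hsq := int_eq_of_between (n := n) (m := x 1 + (0)) (by push_cast; linarith) (by push_cast; linarith)
        rw [hsq] at hn; push_cast at hn; linarith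
      · simp only [lform_two, triX_hexCenter, triY_hexCenter, triX_triEmbed, triY_triEmbed] at hn
        simp at hn
        have hsq := int_eq_of_between (n := n) (m := x 0 + x 1 + (0)) (by push_cast; linarith) (by push_cast; linarith)
        rw [hsq] at hn; push_cast at hn; linarith
    subst hφ
    simp
  · -- up/down = 1, vertex 0
    rw [show faceVertex (x, 1) 0 = x + Pi.single 0 1 from rfl] at hn ⊢
    have hφ : φ = 1 := by
      obtain rfl | rfl | rfl : i = 0 ∨ i = 1 ∨ i = 2 := by fin_cases i <;> simp
      · simp only [lform_zero, triX_hexCenter, triX_triEmbed] at hn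
        simp at hn
        have hsq := int_eq_of_between (n := n) (m := x 0 + (0)) (by push_cast; linarith) (by push_cast; linarith)
        rw [hsq] at hn; push_cast at hn; linarith
      · simp only [lform_one, triY_hexCenter, triY_triEmbed] at hn
        simp at hn
        have hsq := int_eq_of_between (n := n) (m := x 1 + (-1)) (by push_cast; linarith) (by push_cast; linarith)
        rw [hsq] at hn; push_cast at hn; linarith
      · simp only [lform_two, triX_hexCenter, triY_hexCenter, triX_triEmbed, triY_triEmbed] at hn
        simp at hn
        have hsq := int_eq_of_between (n := n) (m := x 0 + x 1 + (0)) (by push_cast; linarith) (by push_cast; linarith)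
        rw [hsq] at hn; push_cast at hn; linarith
    subst hφ
    simp
  · -- up/down = 1, vertex 1
    rw [show faceVertex (x, 1) 1 = x + Pi.single 0 1 + Pi.single 1 1 from rfl] at hn ⊢
    have hφ : φ = 1 := by
      obtain rfl | rfl | rfl : i = 0 ∨ i = 1 ∨ i = 2 := by fin_cases i <;> simp
      · simp only [lform_zero, triX_hexCenter, triX_triEmbed] at hn
        simp at hn
        have hsq := int_eq_of_between (n := n) (m := x 0 + (0)) (by push_cast; linarith) (by push_cast; linarith)
        rw [hsq] at hn; push_cast at hn; linarith
      · simp only [lform_one, triY_hexCenter, triY_triEmbed] at hn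
        simp at hn
        have hsq := int_eq_of_between (n := n) (m := x 1 + (0)) (by push_cast; linarith) (by push_cast; linarith)
        rw [hsq] at hn; push_cast at hn; linarith
      · simp only [lform_two, triX_hexCenter, triY_hexCenter, triX_triEmbed, triY_triEmbed] at hn
        simp at hn
        have hsq := int_eq_of_between (n := n) (m := x 0 + x 1 + (1)) (by push_cast; linarith) (by push_cast; linarith)
        rw [hsq] at hn; push_cast at hn; linarith
    subst hφ
    simp
  · -- up/down = 1, vertex 2
    rw [show faceVertex (x, 1) 2 = x + Pi.single 1 1 from rfl] at hn ⊢
    have hφ : φ = 1 := by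
      obtain rfl | rfl | rfl : i = 0 ∨ i = 1 ∨ i = 2 := by fin_cases i <;> simp
      · simp only [lform_zero, triX_hexCenter, triX_triEmbed] at hn
        simp at hn
        have hsq := int_eq_of_between (n := n) (m := x 0 + (-1)) (by push_cast; linarith) (by push_cast; linarith)
        rw [hsq] at hn; push_cast at hn; linarith
      · simp only [lform_one, triY_hexCenter, triY_triEmbed] at hn
        simp at hn
        have hsq := int_eq_of_between (n := n) (m := x 1 + (0)) (by push_cast; linarith) (by push_cast; linarith)
        rw [hsq] at hn; push_cast at hn; linarith
      · simp only [lform_two, triX_hexCenter, triY_hexCenter, triX_triEmbed, triY_triEmbed] at hn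
        simp at hn
        have hsq := int_eq_of_between (n := n) (m := x 0 + x 1 + (0)) (by push_cast; linarith) (by push_cast; linarith)
        rw [hsq] at hn; push_cast at hn; linarith
    subst hφ
    simp


/-! ### Consequences: which unit edges meet the two kinds of segments -/

/-- The forms of a midpoint. [folklore] -/
theorem lform_midpoint (i : Fin 3) (z w : ℂ) : lform i (midpoint ℝ z w) = (lform i z + lform i w) / 2 := by
  fin_cases i
  · exact triX_midpoint z w
  · exact triY_midpoint z w
  · change triX _ + triY _ = (triX z + triY z + (triX w + triY w)) / 2
    rw [triX_midpoint, triY_midpoint]; ring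

/-- Consecutive vertices of a face differ by a direction. [folklore] -/
theorem faceVertex_add_two_eq (F : HexVertex) (j : Fin 3) :
    faceVertex F (j + 2) = faceVertex F (j + 1) + triDir (faceDartDir F (j + 1)) := by
  rw [← faceVertex_succ, add_assoc]; rfl

/-- **The midpoint of a side of a face is not a lattice point** (one of its forms is a half-odd
integer). [folklore] -/
theorem midpoint_side_ne_triEmbed (F : HexVertex) (j : Fin 3) (v : Site 2) :
    midpoint ℝ (triEmbed (faceVertex F (j + 1))) (triEmbed (faceVertex F (j + 2))) ≠ triEmbed v := by
  intro h
  set κ := faceDartDir F (j + 1)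
  have hi : ltype κ + 1 ≠ ltype κ := by
    generalize ltype κ = τ; fin_cases τ <;> decide
  have hm := congrArg (lform (ltype κ + 1)) h
  rw [lform_midpoint, faceVertex_add_two_eq, lform_triEmbed_add_triDir, lform_triEmbed, lform_triEmbed] at hm
  rcases ldelta_eq_one_or_of_ne hi with he | he <;> rw [he] at hm
  · have h2 : (2 : ℝ) * ![v 0, v 1, v 0 + v 1] (ltype κ + 1) =
        2 * ![faceVertex F (j + 1) 0, faceVertex F (j + 1) 1, faceVertex F (j + 1) 0 + faceVertex F (j + 1) 1] (ltype κ + 1) + 1 := by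
      linarith
    have h3 : (2 : ℤ) * ![v 0, v 1, v 0 + v 1] (ltype κ + 1) =
        2 * ![faceVertex F (j + 1) 0, faceVertex F (j + 1) 1, faceVertex F (j + 1) 0 + faceVertex F (j + 1) 1] (ltype κ + 1) + 1 := by
      exact_mod_cast h2
    omega
  · have h2 : (2 : ℝ) * ![v 0, v 1, v 0 + v 1] (ltype κ + 1) =
        2 * ![faceVertex F (j + 1) 0, faceVertex F (j + 1) 1, faceVertex F (j + 1) 0 + faceVertex F (j + 1) 1] (ltype κ + 1) - 1 := by
      linarith
    have h3 : (2 : ℤ) * ![v 0, v 1, v 0 + v 1] (ltype κ + 1) =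
        2 * ![faceVertex F (j + 1) 0, faceVertex F (j + 1) 1, faceVertex F (j + 1) 0 + faceVertex F (j + 1) 1] (ltype κ + 1) - 1 := by
      exact_mod_cast h2
    omega

/-- A unit edge or a point: the closed segment between two equal-or-adjacent lattice points. For
a point, membership is equality. [folklore] -/
theorem eq_of_mem_segment_self {a : Site 2} {q : ℂ} (hq : q ∈ segment ℝ (triEmbed a) (triEmbed a)) :
    q = triEmbed a := by
  rw [segment_same] at hq; exact hq

/-- **A unit edge (or lattice point) meeting the segment between two adjacent face centres is the
common side of the two faces.** [folklore] -/
theorem eq_side_of_segment_inter_segment_hexCenter {F : HexVertex} {j : Fin 3} {a b : Site 2}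
    (hab : a = b ∨ triGraph.Adj a b) {q : ℂ} (hq1 : q ∈ segment ℝ (triEmbed a) (triEmbed b))
    (hq2 : q ∈ segment ℝ (hexCenter F) (hexCenter (oppFace F j))) :
    (a = faceVertex F (j + 1) ∧ b = faceVertex F (j + 2)) ∨ (a = faceVertex F (j + 2) ∧ b = faceVertex F (j + 1)) := by
  set s₁ := faceVertex F (j + 1) with hs₁
  set κ := faceDartDir F (j + 1) with hκ
  have hs₂ : faceVertex F (j + 2) = s₁ + triDir κ := faceVertex_add_two_eq F j
  rcases hab with rfl | hab
  · -- a point: a lattice point between the centres would be the midpoint, which is not one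
    exfalso
    have hq := eq_of_mem_segment_self hq1
    have hmid := eq_midpoint_of_mem_segment_hexCenter_oppFace hq2 (i := 0) (n := a 0)
      (by rw [hq, lform_triEmbed]; rfl)
    rw [hq] at hmid
    exact midpoint_side_ne_triEmbed F j a hmid.symm
  · obtain ⟨k, rfl⟩ := (triGraph_adj_iff_triDir a b).1 hab
    -- `q` has an integral form, so it is the midpoint of the side
    have hint : lform (ltype k) q = ((![a 0, a 1, a 0 + a 1] (ltype k) : ℤ) : ℝ) := by
      rw [lform_ltype_of_mem_unitEdge hq1, lform_triEmbed]
    have hmid := eq_midpoint_of_mem_segment_hexCenter_oppFace hq2 hint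
    -- the midpoint of the side `[s₁, s₁ + dir κ]` lies on both unit edges
    rw [hs₂] at hmid ⊢
    have hm1 : q ∈ segment ℝ (triEmbed s₁) (triEmbed (s₁ + triDir κ)) := by
      rw [hmid]; exact midpoint_mem_segment _ _
    rcases unitEdge_inter hq1 hm1 with ⟨-, hend⟩ | ⟨h1, h2⟩ | ⟨h1, h2⟩
    · exfalso
      have hne : triEmbed s₁ ≠ triEmbed (s₁ + triDir κ) := fun h =>
        add_triDir_ne s₁ κ (triEmbed_injective h).symm
      rcases hend with h | h
      · rw [hmid, midpoint_eq_left_iff] at h; exact hne h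
      · rw [hmid, midpoint_eq_right_iff] at h; exact hne h
    · exact Or.inl ⟨h1, h2⟩
    · exact Or.inr ⟨h1, h2⟩

/-- **A unit edge (or lattice point) meeting the segment from a face centre to a vertex of the
face contains that vertex as an endpoint.** [folklore] -/
theorem eq_vertex_of_segment_inter_segment_hexCenter_faceVertex {F : HexVertex} {v : Fin 3} {a b : Site 2}
    (hab : a = b ∨ triGraph.Adj a b) {q : ℂ} (hq1 : q ∈ segment ℝ (triEmbed a) (triEmbed b))
    (hq2 : q ∈ segment ℝ (hexCenter F) (triEmbed (faceVertex F v))) :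
    faceVertex F v = a ∨ faceVertex F v = b := by
  rcases hab with rfl | hab
  · have hq := eq_of_mem_segment_self hq1
    have hv := eq_vertex_of_mem_segment_hexCenter_faceVertex hq2 (i := 0) (n := a 0)
      (by rw [hq, lform_triEmbed]; rfl)
    rw [hq] at hv
    exact Or.inl (triEmbed_injective hv).symm
  · obtain ⟨k, rfl⟩ := (triGraph_adj_iff_triDir a b).1 hab
    have hint : lform (ltype k) q = ((![a 0, a 1, a 0 + a 1] (ltype k) : ℤ) : ℝ) := by
      rw [lform_ltype_of_mem_unitEdge hq1, lform_triEmbed]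
    have hv := eq_vertex_of_mem_segment_hexCenter_faceVertex hq2 hint
    rw [hv] at hq1
    rcases eq_or_eq_of_triEmbed_mem_unitEdge hq1 with h | h
    · exact Or.inl h
    · exact Or.inr h

end Literature.Probability.Percolation

end
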